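/-
Copyright (c) 2026. All rights reserved.
Released under Apache 2.0 license as described in the file LICENSE.
-/
import Summits.HodgeConjecture.HodgeConjecture.Theorems.K2LiuArchSiegelCharacterTube       -- ★ (law) `detDeltaM_eq_det_toBlocks₁₁_of_tube`, `modDelta_archToAdelic_eq_prod`, `isComplex_infinitePlace` (+ ★ `isSiegelDelta_archPiEquivCM_symm_iff`)
import Summits.HodgeConjecture.HodgeConjecture.Theorems.K2LiuIwasawaDeltaUnimodular        -- ★ `IwasawaDatum.modDelta_eq_one_of_mem`
import Summits.HodgeConjecture.HodgeConjecture.Theorems.K2LiuHolTubeRigidityOfFrame         -- ★ frame letters `frame_mul`, `frame_mem`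
import Summits.HodgeConjecture.HodgeConjecture.Theorems.K2LiuArchInducedTubeSection         -- ★ (A∞-0) `det_denom_mul_of_siegel`, `det_toBlocks₂₂_of_mem_siegel`, `norm_det_denom_of_stab`
import Literature.NumberTheory.K2Lit.SiegelStandardExtension                                -- ★ `IwasawaDatum.pPart`, `IwasawaDatum.modDelta_pPart_eq`
import HarnessLib

/-!
# Crux `HLiu418`, G6-arch ASSEMBLY FILE 14 — (E8rec) DICTIONARY, brick (D-C′): THE IWASAWA HEIGHT OF THE DATUM READ THROUGH THE TUBE FRAME
# `modDelta (𝒦.pPart (a, 1)) · ∏_w ‖j(Fr a w, i1)‖ = 1` for `a = p·k`, `p ∈ P_Δ(L⁺ ⊗ ℝ)`, `(k,1) ∈ 𝒦.K` framed into `Stab(i1)` at every complex place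

Cell `hodgecm-mathlib`, crux item hLiu418 = `stmt-HodgeConjecture-24832` (helper lane `--supports`, count-neutral).  K2Liu-p11 (g4) (E8rec) dictionary census
22:28Z, brick (D-C′); consumer: the (β) END file (K2Liu-p13 (g4)).  With ★ FILE 13 `K2LiuArchSectionFlatTwist` (brick (D-D)) it turns (E6′)'s flat arch factor
`H_∞(a)^{2(s−s₀)} · A(a)`, `H_∞(a) := modDelta (𝒦.pPart (archToAdelic a))` (★ `K2LiuStdFamilyAwayPurityFlat.exists_awayPurity_flat`), into the product of tube-side flat
twists `‖j(Fr a w, i1)‖^{2(s₀−s)}` that ★ (E8) END `K2LiuArchBlockOfFrameEnd.exists_continuation_integral_unipDeltaArch` integrates — for every `a = p·k` whose compact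
factor `k` has `(k, 1) ∈ 𝒦.K` AND frames into `Stab(i1)` (the frame-compact class of data; for a general standard datum after the right translation of brick (D-C)).
* §1 (tube, any size `l`) **`norm_det_toBlocks₁₁_mul_norm_det_denom`** — for `P ∈ U(J) ∩ P_Δ` and `u ∈ Stab(i1)`: `‖det P₁₁‖ · ‖j(P u, i1)‖ = 1`
  (`j(Pu, i1) = det P₂₂ · j(u, i1)`, `det P₂₂ = (conj det P₁₁)⁻¹`, `‖j(u, i1)‖ = 1`).
* §2 (arch, the frame of record BY VALUE: `(T, Tinv, Fr, hFr, hT2, hTU)` of ★ `K2LiuHolTubeRigidityOfFrame` §2, the parabolic clause `hTS` of ★ `exists_tubeFrame_arch₃`, and the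
  SHIMURA SHAPE `T_w = (D_w D_w; C_w −C_w)` with `D_w, C_w` invertible of ★ `exists_tubeFrame_arch₄` (x) ∕ ★ `isUnit_det_shimuraFrame`):
  `isSiegelM_archAt` (`p ∈ P_Δ(L⁺⊗ℝ) ⇒` every place component is `IsSiegelM`, ★ `isSiegelDelta_archPiEquivCM_symm_iff`), `frame_toBlocks₂₁_eq_zero` (its frame is tube-Siegel),
  `norm_detDeltaM_archAt_eq` (`‖x(p_w)‖ = ‖det (Fr p w)₁₁‖`, ★ `detDeltaM_eq_det_toBlocks₁₁_of_tube`), and the head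
  **`modDelta_pPart_mul_prod_norm_det_denom_eq_one`**: `modDelta (𝒦.pPart (archToAdelic a)) · ∏_w ‖j(Fr a w, i1)‖ = 1`
  (★ `IwasawaDatum.modDelta_pPart_eq` + ★ `IwasawaDatum.modDelta_eq_one_of_mem`, ★ `modDelta_archToAdelic_eq_prod` re-indexed over the complex places, §1 place by place).
References: [Shimura1997, §§5–6, §16.4]; [Kudla1994, §3]; [Tan1999, §1]; [BorelJacquet1979, §4.1].
HONEST LABEL: HC_CM is proved only modulo the 7 printed citations (2 remaining named inputs: hLiu418 = stmt-HodgeConjecture-24832,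
h413 = stmt-HodgeConjecture-24833) until rung 0 closes; count-neutral helper, closes no socket.
-/

set_option autoImplicit false
set_option linter.dupNamespace false

noncomputable section

open scoped Matrix ComplexConjugate
open Complex Matrix NumberField NumberField.InfinitePlace
open Literature.NumberTheory.ModularForms.SiegelUpperHalfSpace (denom moeb)
open Literature.NumberTheory.Automorphic Literature.NumberTheory.Automorphic.UnitaryGroup
open Literature.NumberTheory.GelbartRogawski1991 Literature.NumberTheory.GelbartRogawski1991.GRConstruction
open Literature.NumberTheory.GelbartRogawski1991.UnitaryDualPair
open Literature.NumberTheory.K2Lit.SiegelDoubled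

namespace Summit.HodgeConjecture.HodgeConjecture.Cruxes.HLiu418.K2LiuArchHeightOfFrame

open K2LiuHermitianTubeCocycle K2LiuArchInducedTubeSectionPrelims K2LiuHolTubeRigidityOfFrame K2LiuArchSiegelCharacterTube K2LiuIwasawaDeltaUnimodular
open K2LiuArchSliceSiegel (isSiegelDelta_archPiEquivCM_symm_iff)

/-! ## §1  Tube: `‖det P₁₁‖ · ‖j(P u, i1)‖ = 1` -/

section Tube

variable {l : Type*} [Fintype l] [DecidableEq l]

/-- **`‖det P₁₁‖ · ‖j(P·u, i1)‖ = 1`** for `P ∈ U(J) ∩ P_Δ` and `u ∈ U(J)` fixing `i·1`: the tube height `‖det A_P‖` of `g = P·u` is `‖j(g, i1)‖⁻¹`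
(★ `det_denom_mul_of_siegel`, ★ `det_toBlocks₂₂_of_mem_siegel`, ★ `norm_det_denom_of_stab`). [Shimura1997, §§5–6, §16.4] -/
theorem norm_det_toBlocks₁₁_mul_norm_det_denom {P u : Matrix (l ⊕ l) (l ⊕ l) ℂ} (hP : Pᴴ * Matrix.J l ℂ * P = Matrix.J l ℂ) (hp : P.toBlocks₂₁ = 0)
    (hU : uᴴ * Matrix.J l ℂ * u = Matrix.J l ℂ) (hI : moeb u (I • (1 : Matrix l l ℂ)) = I • 1) :
    ‖P.toBlocks₁₁.det‖ * ‖(denom (P * u) (I • (1 : Matrix l l ℂ))).det‖ = 1 := by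
  obtain ⟨hne, h22⟩ := det_toBlocks₂₂_of_mem_siegel hP hp
  rw [det_denom_mul_of_siegel hp, h22, norm_mul, norm_det_denom_of_stab hU hI, mul_one, norm_inv, Complex.norm_conj,
    mul_inv_cancel₀ (norm_ne_zero_iff.2 hne)]

end Tube

/-! ## §2  Arch: the Iwasawa height of the datum through the frame -/

section Arch

variable (L : Type) [Field L] [NumberField L] [IsCMField L] {N M n : ℕ} (e : Fin N × Fin M ≃ Fin n)
  (dV : Fin N → L) (hdV : ∀ i, IsCMField.complexConj L (dV i) = dV i) (hdV0 : ∀ i, dV i ≠ 0)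
  (dW : Fin M → L) (hdW : ∀ i, IsCMField.complexConj L (dW i) = dW i) (hdW0 : ∀ i, dW i ≠ 0)
  (T Tinv : {w : InfinitePlace L // w.IsComplex} → Matrix (Fin n ⊕ Fin n) (Fin n ⊕ Fin n) ℂ)
  (Fr : UnitaryGroup.arch (Fp L) L (IsCMField.complexConj L) (n + n) (hermD L e dV hdV dW hdW) →
    {w : InfinitePlace L // w.IsComplex} → Matrix (Fin n ⊕ Fin n) (Fin n ⊕ Fin n) ℂ)
  (hFr : ∀ a w, Fr a w = T w * Matrix.reindex (e₂ (n := n)).symm (e₂ (n := n)).symm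
    (((UnitaryGroup.archAt (Fp L) L (IsCMField.complexConj L) (n + n) (hermD L e dV hdV dW hdW) w
      (UnitaryGroup.complexConj_smul_infinitePlace L w.1) (IsCMField.complexConj_ne_one L) a :
        UnitaryGroup.archLocal L (n + n) (hermD L e dV hdV dW hdW) w) : GL (Fin (n + n)) ℂ) : Matrix (Fin (n + n)) (Fin (n + n)) ℂ) * Tinv w)
  (hT2 : ∀ w, Tinv w * T w = 1)
  (hTU : ∀ w (g : GL (Fin (n + n)) ℂ), g ∈ UnitaryGroup.archLocal L (n + n) (hermD L e dV hdV dW hdW) w →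
    (T w * Matrix.reindex (e₂ (n := n)).symm (e₂ (n := n)).symm (g : Matrix _ _ ℂ) * Tinv w)ᴴ * Matrix.J (Fin n) ℂ *
      (T w * Matrix.reindex (e₂ (n := n)).symm (e₂ (n := n)).symm (g : Matrix _ _ ℂ) * Tinv w) = Matrix.J (Fin n) ℂ)
  (hTS : ∀ w (g : GL (Fin (n + n)) ℂ), IsSiegelM (n := n) (g : Matrix (Fin (n + n)) (Fin (n + n)) ℂ) →
    (T w * Matrix.reindex (e₂ (n := n)).symm (e₂ (n := n)).symm (g : Matrix _ _ ℂ) * Tinv w).toBlocks₂₁ = 0)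
  (D C : {w : InfinitePlace L // w.IsComplex} → Matrix (Fin n) (Fin n) ℂ)
  (hTsh : ∀ w, T w = fromBlocks (D w) (D w) (C w) (-(C w))) (hD : ∀ w, IsUnit (D w).det) (hC : ∀ w, IsUnit (C w).det)

/-- **every place component of an archimedean Siegel element is `IsSiegelM`** (★ `isSiegelDelta_archPiEquivCM_symm_iff` at `u := archPiEquivCM a`). [BorelJacquet1979, §4.1] -/
theorem isSiegelM_archAt {p : UnitaryGroup.arch (Fp L) L (IsCMField.complexConj L) (n + n) (hermD L e dV hdV dW hdW)}
    (hp : IsSiegelDelta L e dV hdV dW hdW (UnitaryGroup.archToAdelic (Fp L) L (IsCMField.complexConj L) (n + n) (hermD L e dV hdV dW hdW) p))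
    (w : {w : InfinitePlace L // w.IsComplex}) :
    IsSiegelM (n := n) (((UnitaryGroup.archAt (Fp L) L (IsCMField.complexConj L) (n + n) (hermD L e dV hdV dW hdW) w
      (UnitaryGroup.complexConj_smul_infinitePlace L w.1) (IsCMField.complexConj_ne_one L) p :
        UnitaryGroup.archLocal L (n + n) (hermD L e dV hdV dW hdW) w) : GL (Fin (n + n)) ℂ) : Matrix (Fin (n + n)) (Fin (n + n)) ℂ) := by
  have h := (isSiegelDelta_archPiEquivCM_symm_iff L e dV hdV dW hdW (UnitaryGroup.archPiEquivCM (n + n) L (hermD L e dV hdV dW hdW) p)).1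
    (by rwa [ContinuousMulEquiv.symm_apply_apply]) w
  exact h

include hFr hTS in
/-- **the frame of an archimedean Siegel element is tube-Siegel**: `(Fr p w)₂₁ = 0` (parabolic clause `hTS`). [Shimura1997, §6] -/
theorem frame_toBlocks₂₁_eq_zero {p : UnitaryGroup.arch (Fp L) L (IsCMField.complexConj L) (n + n) (hermD L e dV hdV dW hdW)}
    (hp : IsSiegelDelta L e dV hdV dW hdW (UnitaryGroup.archToAdelic (Fp L) L (IsCMField.complexConj L) (n + n) (hermD L e dV hdV dW hdW) p))
    (w : {w : InfinitePlace L // w.IsComplex}) : (Fr p w).toBlocks₂₁ = 0 := by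
  rw [hFr]
  exact hTS w _ (isSiegelM_archAt L e dV hdV dW hdW hp w)

include hFr hT2 hTS hTsh hD hC in
/-- **Kudla's `x` of a place component is the Levi block of its frame**: `‖detDeltaM (p_w)‖ = ‖det (Fr p w)₁₁‖` for `p ∈ P_Δ(L⁺ ⊗ ℝ)` (★ `detDeltaM_eq_det_toBlocks₁₁_of_tube`
at the Shimura shape of `T_w`). [Kudla1994, §3] [Shimura1997, §6] -/
theorem norm_detDeltaM_archAt_eq {p : UnitaryGroup.arch (Fp L) L (IsCMField.complexConj L) (n + n) (hermD L e dV hdV dW hdW)}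
    (hp : IsSiegelDelta L e dV hdV dW hdW (UnitaryGroup.archToAdelic (Fp L) L (IsCMField.complexConj L) (n + n) (hermD L e dV hdV dW hdW) p))
    (w : {w : InfinitePlace L // w.IsComplex}) :
    ‖detDeltaM (n := n) (((UnitaryGroup.archAt (Fp L) L (IsCMField.complexConj L) (n + n) (hermD L e dV hdV dW hdW) w
        (UnitaryGroup.complexConj_smul_infinitePlace L w.1) (IsCMField.complexConj_ne_one L) p :
          UnitaryGroup.archLocal L (n + n) (hermD L e dV hdV dW hdW) w) : GL (Fin (n + n)) ℂ) : Matrix (Fin (n + n)) (Fin (n + n)) ℂ)‖ =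
      ‖(Fr p w).toBlocks₁₁.det‖ := by
  have hinv : Tinv w * fromBlocks (D w) (D w) (C w) (-(C w)) = 1 := by rw [← hTsh]; exact hT2 w
  have hP : (fromBlocks (D w) (D w) (C w) (-(C w)) * Matrix.reindex (e₂ (n := n)).symm (e₂ (n := n)).symm
      (((UnitaryGroup.archAt (Fp L) L (IsCMField.complexConj L) (n + n) (hermD L e dV hdV dW hdW) w
        (UnitaryGroup.complexConj_smul_infinitePlace L w.1) (IsCMField.complexConj_ne_one L) p :
          UnitaryGroup.archLocal L (n + n) (hermD L e dV hdV dW hdW) w) : GL (Fin (n + n)) ℂ) : Matrix (Fin (n + n)) (Fin (n + n)) ℂ) * Tinv w).toBlocks₂₁ = 0 := by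
    rw [← hTsh]
    exact hTS w _ (isSiegelM_archAt L e dV hdV dW hdW hp w)
  rw [detDeltaM_eq_det_toBlocks₁₁_of_tube (D w) (C w) (Tinv w) hinv (hD w) (hC w) _ hP, ← hTsh, ← hFr]

include hFr hT2 hTU hTS hTsh hD hC hdV0 hdW0 in
/-- **THE IWASAWA HEIGHT OF THE DATUM THROUGH THE TUBE FRAME.**  For an Iwasawa datum `𝒦` and `a = p·k ∈ H_∞` with `p ∈ P_Δ(L⁺ ⊗ ℝ)`, `(k, 1) ∈ 𝒦.K` and
`Fr k w ∈ Stab(i1)` at every complex place: `modDelta (𝒦.pPart (archToAdelic a)) · ∏_w ‖j(Fr a w, i1)‖ = 1` — i.e. (E6′)'s height `H_∞(a)` IS `∏_w ‖j(Fr a w, i1)‖⁻¹`,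
the product of the tube heights of ★ FILE 13's flat twists. [Tan1999, §1] [Kudla1994, §3] [Shimura1997, §16.4] [BorelJacquet1979, §4.1] -/
theorem modDelta_pPart_mul_prod_norm_det_denom_eq_one [Fintype {w : InfinitePlace L // w.IsComplex}]
    (𝒦 : IwasawaDatum L e dV hdV dW hdW) {a p k : UnitaryGroup.arch (Fp L) L (IsCMField.complexConj L) (n + n) (hermD L e dV hdV dW hdW)} (ha : a = p * k)
    (hp : IsSiegelDelta L e dV hdV dW hdW (UnitaryGroup.archToAdelic (Fp L) L (IsCMField.complexConj L) (n + n) (hermD L e dV hdV dW hdW) p))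
    (hk : (UnitaryGroup.archToAdelic (Fp L) L (IsCMField.complexConj L) (n + n) (hermD L e dV hdV dW hdW) k : HA L e dV hdV dW hdW) ∈ 𝒦.K)
    (hkS : ∀ w, moeb (Fr k w) (I • (1 : Matrix (Fin n) (Fin n) ℂ)) = I • 1) :
    modDelta L e dV hdV dW hdW (𝒦.pPart (UnitaryGroup.archToAdelic (Fp L) L (IsCMField.complexConj L) (n + n) (hermD L e dV hdV dW hdW) a)) *
      ∏ w : {w : InfinitePlace L // w.IsComplex}, ‖(denom (Fr a w) (I • (1 : Matrix (Fin n) (Fin n) ℂ))).det‖ = 1 := by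
  have hK := IwasawaDatum.modDelta_eq_one_of_mem L e dV hdV hdV0 dW hdW hdW0 𝒦
  rw [IwasawaDatum.modDelta_pPart_eq hK hp hk (by rw [ha, map_mul]; rfl), modDelta_archToAdelic_eq_prod L e dV hdV dW hdW p hp]
  -- re-index the place product over the complex places (every infinite place of the CM field `L` is complex)
  have hre : (∏ w' : InfinitePlace L, ‖detDeltaM (n := n) (((UnitaryGroup.archAt (Fp L) L (IsCMField.complexConj L) (n + n) (hermD L e dV hdV dW hdW)
        ⟨w', isComplex_infinitePlace L w'⟩ (UnitaryGroup.complexConj_smul_infinitePlace L w') (IsCMField.complexConj_ne_one L) p :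
          UnitaryGroup.archLocal L (n + n) (hermD L e dV hdV dW hdW) ⟨w', isComplex_infinitePlace L w'⟩) : GL (Fin (n + n)) ℂ) : Matrix (Fin (n + n)) (Fin (n + n)) ℂ)‖) =
      ∏ w : {w : InfinitePlace L // w.IsComplex}, ‖detDeltaM (n := n) (((UnitaryGroup.archAt (Fp L) L (IsCMField.complexConj L) (n + n) (hermD L e dV hdV dW hdW) w
        (UnitaryGroup.complexConj_smul_infinitePlace L w.1) (IsCMField.complexConj_ne_one L) p :
          UnitaryGroup.archLocal L (n + n) (hermD L e dV hdV dW hdW) w) : GL (Fin (n + n)) ℂ) : Matrix (Fin (n + n)) (Fin (n + n)) ℂ)‖ :=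
    Fintype.prod_equiv (Equiv.subtypeUnivEquiv (fun w : InfinitePlace L => isComplex_infinitePlace L w)).symm _ _ (fun _ => rfl)
  rw [hre, ← Finset.prod_mul_distrib]
  refine Finset.prod_eq_one fun w _ => ?_
  rw [norm_detDeltaM_archAt_eq L e dV hdV dW hdW T Tinv Fr hFr hT2 hTS D C hTsh hD hC hp w, ha, frame_mul L e dV hdV dW hdW T Tinv Fr hFr hT2]
  exact norm_det_toBlocks₁₁_mul_norm_det_denom (frame_mem L e dV hdV dW hdW T Tinv Fr hFr hTU p w)
    (frame_toBlocks₂₁_eq_zero L e dV hdV dW hdW T Tinv Fr hFr hTS hp w) (frame_mem L e dV hdV dW hdW T Tinv Fr hFr hTU k w) (hkS w)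

include hFr hT2 hTU hTS hTsh hD hC hdV0 hdW0 in
/-- **the same, solved for the height** (a real power reading): `modDelta (𝒦.pPart (archToAdelic a)) = (∏_w ‖j(Fr a w, i1)‖)⁻¹`. [Tan1999, §1] [Shimura1997, §16.4] -/
theorem modDelta_pPart_eq_inv_prod_norm_det_denom [Fintype {w : InfinitePlace L // w.IsComplex}]
    (𝒦 : IwasawaDatum L e dV hdV dW hdW) {a p k : UnitaryGroup.arch (Fp L) L (IsCMField.complexConj L) (n + n) (hermD L e dV hdV dW hdW)} (ha : a = p * k)
    (hp : IsSiegelDelta L e dV hdV dW hdW (UnitaryGroup.archToAdelic (Fp L) L (IsCMField.complexConj L) (n + n) (hermD L e dV hdV dW hdW) p))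
    (hk : (UnitaryGroup.archToAdelic (Fp L) L (IsCMField.complexConj L) (n + n) (hermD L e dV hdV dW hdW) k : HA L e dV hdV dW hdW) ∈ 𝒦.K)
    (hkS : ∀ w, moeb (Fr k w) (I • (1 : Matrix (Fin n) (Fin n) ℂ)) = I • 1) :
    modDelta L e dV hdV dW hdW (𝒦.pPart (UnitaryGroup.archToAdelic (Fp L) L (IsCMField.complexConj L) (n + n) (hermD L e dV hdV dW hdW) a)) =
      (∏ w : {w : InfinitePlace L // w.IsComplex}, ‖(denom (Fr a w) (I • (1 : Matrix (Fin n) (Fin n) ℂ))).det‖)⁻¹ := by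
  exact eq_inv_of_mul_eq_one_left
    (modDelta_pPart_mul_prod_norm_det_denom_eq_one L e dV hdV hdV0 dW hdW hdW0 T Tinv Fr hFr hT2 hTU hTS D C hTsh hD hC 𝒦 ha hp hk hkS)

end Arch

end Summit.HodgeConjecture.HodgeConjecture.Cruxes.HLiu418.K2LiuArchHeightOfFrame

end
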